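import Mathlib
import HarnessLib

/-!
# The order of the automorphism group of a finite group: `|Aut N| ≤ ∏_{i<[log₂ |N|]} (|N| - 2^i)`

Topic `Literature/GroupTheory/PermutationGroups` (consumed by `RegularNormalSubgroupOrder.lean`:
the order of a permutation group with a regular normal subgroup — the affine / twisted-wreath
step of the proof of Maróti 2002, Theorem 1.1 (iii)). Fully PROVED folklore; no definitions
(the "doubling" condition on a tuple `t : Fin k → N` — every entry lies outside the subgroup
generated by the earlier entries — is written out as
`∀ j, t j ∉ Subgroup.closure (t '' {l | (l : ℕ) < j})`).

* `two_mul_card_le_card_of_not_mem` — `H ≤ K` and `x ∈ K ∖ H` give `2 · |H| ≤ |K|` (Lagrange).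
* `two_pow_le_card_closure_prefix` — in a doubling tuple the first `i` entries generate a
  subgroup of order `≥ 2^i`.
* `card_filter_doubling_le_prod` — there are at most `∏_{i<k} (|N| - 2^i)` doubling `k`-tuples
  (the `(i+1)`-st entry avoids a subgroup of order `≥ 2^i`).
* `exists_doubling_generators` — every finite group has a GENERATING doubling tuple (greedy),
  necessarily of length `d` with `2^d ≤ |N|`.
* `card_mulAut_le_prod` — **`|Aut N| ≤ ∏_{i<[log₂ |N|]} (|N| - 2^i)`**: an automorphism is
  determined by the images of a generating doubling tuple, and these images form a doubling
  tuple. (Equality for `N = 𝔽₂^d`: `|GL(d, 2)| = ∏_{i<d} (2^d - 2^i)`.)  Cruder: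
  `card_mulAut_le_pow_log` — `|Aut N| ≤ |N|^{[log₂ |N|]}`.
-/

namespace Literature.GroupTheory.PermutationGroups

open Subgroup

section Doubling

variable {N : Type*} [Group N]

/-- If `H ≤ K` are subgroups and some element of `K` is not in `H`, then `2 · |H| ≤ |K|`
(Lagrange: `|H|` is a proper divisor of `|K|`). [folklore] -/
theorem two_mul_card_le_card_of_not_mem {H K : Subgroup N} [Finite K] (hHK : H ≤ K) {x : N}
    (hxK : x ∈ K) (hxH : x ∉ H) : 2 * Nat.card H ≤ Nat.card K := by
  have hlt : Nat.card H < Nat.card K := by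
    by_contra hle
    push Not at hle
    have hEq : H = K := Subgroup.eq_of_le_of_card_ge hHK hle
    rw [hEq] at hxH
    exact hxH hxK
  obtain ⟨c, hc⟩ := Subgroup.card_dvd_of_le hHK
  have hc2 : 2 ≤ c := by
    by_contra h
    push Not at h
    have : Nat.card K ≤ Nat.card H := by
      rw [hc]
      calc Nat.card H * c ≤ Nat.card H * 1 := Nat.mul_le_mul_left _ (by omega)
        _ = Nat.card H := mul_one _
    omega
  calc 2 * Nat.card H ≤ c * Nat.card H := Nat.mul_le_mul_right _ hc2
    _ = Nat.card K := by rw [hc, mul_comm]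

/-- **Doubling.** If every entry of `t : Fin k → N` lies outside the subgroup generated by the
earlier entries, then the first `i` entries generate a subgroup of order at least `2^i`.
[folklore] -/
theorem two_pow_le_card_closure_prefix [Finite N] {k : ℕ} {t : Fin k → N}
    (ht : ∀ j : Fin k, t j ∉ closure (t '' {l : Fin k | (l : ℕ) < j})) {i : ℕ} (hi : i ≤ k) :
    2 ^ i ≤ Nat.card (closure (t '' {l : Fin k | (l : ℕ) < i})) := by
  induction i with
  | zero =>
    have h0 : {l : Fin k | (l : ℕ) < 0} = ∅ := by
      ext l
      simp
    rw [h0, Set.image_empty, Subgroup.closure_empty, card_bot, pow_zero]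
  | succ i ih =>
    have hik : i < k := hi
    have hHK : closure (t '' {l : Fin k | (l : ℕ) < i}) ≤
        closure (t '' {l : Fin k | (l : ℕ) < i + 1}) :=
      closure_mono (Set.image_mono fun l (hl : (l : ℕ) < i) => Nat.lt_succ_of_lt hl)
    have hxK : t ⟨i, hik⟩ ∈ closure (t '' {l : Fin k | (l : ℕ) < i + 1}) :=
      subset_closure (Set.mem_image_of_mem t (Nat.lt_succ_self i))
    have hxH : t ⟨i, hik⟩ ∉ closure (t '' {l : Fin k | (l : ℕ) < i}) := ht ⟨i, hik⟩
    calc 2 ^ (i + 1) = 2 * 2 ^ i := by ring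
      _ ≤ 2 * Nat.card (closure (t '' {l : Fin k | (l : ℕ) < i})) :=
          Nat.mul_le_mul_left 2 (ih hik.le)
      _ ≤ _ := two_mul_card_le_card_of_not_mem hHK hxK hxH

omit [Group N] in
/-- Prefix images of a tuple on `Fin (k+1)` are prefix images of its `Fin.init`. [folklore] -/
theorem image_prefix_eq_image_init {k : ℕ} (t : Fin (k + 1) → N) {i : ℕ} (hi : i ≤ k) :
    t '' {l : Fin (k + 1) | (l : ℕ) < i} = Fin.init t '' {l : Fin k | (l : ℕ) < i} := by
  ext x
  simp only [Set.mem_image, Set.mem_setOf_eq]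
  constructor
  · rintro ⟨l, hl, rfl⟩
    exact ⟨l.castLT (lt_of_lt_of_le hl hi), hl, by simp [Fin.init]⟩
  · rintro ⟨l, hl, rfl⟩
    exact ⟨l.castSucc, hl, rfl⟩

omit [Group N] in
/-- The image of all but the last index is the range of `Fin.init`. [folklore] -/
theorem image_prefix_last_eq_range_init {k : ℕ} (t : Fin (k + 1) → N) :
    t '' {l : Fin (k + 1) | (l : ℕ) < k} = Set.range (Fin.init t) := by
  rw [image_prefix_eq_image_init t le_rfl, ← Set.image_univ]
  congr 1
  ext l
  simp

omit [Group N] in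
/-- The image of all indices is the range. [folklore] -/
theorem image_prefix_self_eq_range {k : ℕ} (s : Fin k → N) :
    s '' {l : Fin k | (l : ℕ) < k} = Set.range s := by
  rw [← Set.image_univ]
  congr 1
  ext l
  simp

/-- A `(k+1)`-tuple is doubling iff its `init` is doubling and its last entry lies outside the
subgroup generated by the other entries. [folklore] -/
theorem doubling_succ_iff {k : ℕ} (t : Fin (k + 1) → N) :
    (∀ j : Fin (k + 1), t j ∉ closure (t '' {l : Fin (k + 1) | (l : ℕ) < j})) ↔
      (∀ j : Fin k, Fin.init t j ∉ closure (Fin.init t '' {l : Fin k | (l : ℕ) < j})) ∧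
        t (Fin.last k) ∉ closure (Set.range (Fin.init t)) := by
  constructor
  · intro h
    refine ⟨fun j => ?_, ?_⟩
    · have hj := h j.castSucc
      rw [Fin.val_castSucc, image_prefix_eq_image_init t (le_of_lt j.is_lt)] at hj
      exact hj
    · have hl := h (Fin.last k)
      rw [Fin.val_last, image_prefix_last_eq_range_init] at hl
      exact hl
  · rintro ⟨h1, h2⟩ j
    rcases Fin.eq_castSucc_or_eq_last j with ⟨j, rfl⟩ | rfl
    · rw [Fin.val_castSucc, image_prefix_eq_image_init t (le_of_lt j.is_lt)]
      exact h1 j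
    · rw [Fin.val_last, image_prefix_last_eq_range_init]
      exact h2

/-- **Greedy generation.** Every finite group has a generating doubling tuple; its length `d`
satisfies `2^d ≤ |N|`. [folklore] -/
theorem exists_doubling_generators [Finite N] :
    ∃ d : ℕ, ∃ g : Fin d → N, (∀ j : Fin d, g j ∉ closure (g '' {l : Fin d | (l : ℕ) < j})) ∧
      closure (Set.range g) = ⊤ ∧ 2 ^ d ≤ Nat.card N := by
  -- either a generating doubling tuple of length `≤ k` exists, or a doubling `k`-tuple exists
  have key : ∀ k : ℕ, (∃ d ≤ k, ∃ g : Fin d → N,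
      (∀ j : Fin d, g j ∉ closure (g '' {l : Fin d | (l : ℕ) < j})) ∧
        closure (Set.range g) = ⊤) ∨
      ∃ t : Fin k → N, ∀ j : Fin k, t j ∉ closure (t '' {l : Fin k | (l : ℕ) < j}) := by
    intro k
    induction k with
    | zero => exact Or.inr ⟨fun j => j.elim0, fun j => j.elim0⟩
    | succ k ih =>
      rcases ih with ⟨d, hd, g, hg, hgen⟩ | ⟨t, ht⟩
      · exact Or.inl ⟨d, hd.trans (Nat.le_succ k), g, hg, hgen⟩
      · by_cases htop : closure (Set.range t) = ⊤
        · exact Or.inl ⟨k, Nat.le_succ k, t, ht, htop⟩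
        · obtain ⟨x, hx⟩ : ∃ x, x ∉ closure (Set.range t) := by
            by_contra hall
            push Not at hall
            exact htop ((eq_top_iff' _).mpr hall)
          refine Or.inr ⟨Fin.snoc t x, ?_⟩
          rw [doubling_succ_iff, Fin.init_snoc, Fin.snoc_last]
          exact ⟨ht, hx⟩
  rcases key (Nat.card N) with ⟨d, -, g, hg, hgen⟩ | ⟨t, ht⟩
  · refine ⟨d, g, hg, hgen, ?_⟩
    have h2 := two_pow_le_card_closure_prefix hg le_rfl
    rw [image_prefix_self_eq_range, hgen, card_top] at h2
    exact h2
  · exfalso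
    have h2 := two_pow_le_card_closure_prefix ht le_rfl
    have hle : Nat.card (closure (t '' {l : Fin (Nat.card N) | (l : ℕ) < Nat.card N})) ≤
        Nat.card N := card_le_card_group _
    exact absurd (h2.trans hle) (not_le.mpr Nat.lt_two_pow_self)

end Doubling

section Counting

variable {N : Type*} [Group N] [Fintype N]

open scoped Classical in
/-- **Counting doubling tuples, one step**: a doubling `(k+1)`-tuple is a doubling `k`-tuple
followed by an element outside a subgroup of order `≥ 2^k`. [folklore] -/
theorem card_filter_doubling_succ_le (k : ℕ) :
    (Finset.univ.filter fun t : Fin (k + 1) → N =>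
        ∀ j : Fin (k + 1), t j ∉ closure (t '' {l : Fin (k + 1) | (l : ℕ) < j})).card ≤
      (Fintype.card N - 2 ^ k) *
        (Finset.univ.filter fun s : Fin k → N =>
          ∀ j : Fin k, s j ∉ closure (s '' {l : Fin k | (l : ℕ) < j})).card := by
  set Sk := Finset.univ.filter fun s : Fin k → N =>
    ∀ j : Fin k, s j ∉ closure (s '' {l : Fin k | (l : ℕ) < j}) with hSk
  set Sk1 := Finset.univ.filter fun t : Fin (k + 1) → N =>
    ∀ j : Fin (k + 1), t j ∉ closure (t '' {l : Fin (k + 1) | (l : ℕ) < j}) with hSk1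
  -- the fibre over a doubling `k`-tuple `s`: the admissible last entries
  set F : (Fin k → N) → Finset N := fun s =>
    Finset.univ.filter fun x : N => x ∉ closure (Set.range s) with hF
  have hsub : Sk1 ⊆ Sk.biUnion fun s => (F s).image fun x => (Fin.snoc s x : Fin (k + 1) → N) := by
    intro t ht
    rw [hSk1, Finset.mem_filter] at ht
    obtain ⟨h1, h2⟩ := (doubling_succ_iff t).mp ht.2
    rw [Finset.mem_biUnion]
    refine ⟨Fin.init t, ?_, ?_⟩
    · rw [hSk, Finset.mem_filter]
      exact ⟨Finset.mem_univ _, h1⟩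
    · rw [Finset.mem_image]
      refine ⟨t (Fin.last k), ?_, Fin.snoc_init_self t⟩
      simp only [hF, Finset.mem_filter]
      exact ⟨Finset.mem_univ _, h2⟩
  have hfib : ∀ s ∈ Sk, (F s).card ≤ Fintype.card N - 2 ^ k := by
    intro s hs
    rw [hSk, Finset.mem_filter] at hs
    have h2k : 2 ^ k ≤ Nat.card (closure (Set.range s)) := by
      have h2 := two_pow_le_card_closure_prefix hs.2 le_rfl
      rwa [image_prefix_self_eq_range] at h2
    have hmem : (Finset.univ.filter fun x : N => x ∈ closure (Set.range s)).card =
        Nat.card (closure (Set.range s)) := by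
      rw [Nat.card_eq_fintype_card, ← Fintype.card_subtype]
    have hsplit := Finset.card_filter_add_card_filter_not
      (s := (Finset.univ : Finset N)) (fun x : N => x ∈ closure (Set.range s))
    rw [Finset.card_univ, hmem] at hsplit
    have hFs : (F s).card = Fintype.card N - Nat.card (closure (Set.range s)) := by
      simp only [hF]
      omega
    rw [hFs]
    exact Nat.sub_le_sub_left h2k _
  calc Sk1.card
      ≤ (Sk.biUnion fun s => (F s).image fun x => (Fin.snoc s x : Fin (k + 1) → N)).card :=
        Finset.card_le_card hsub
    _ ≤ ∑ s ∈ Sk, ((F s).image fun x => (Fin.snoc s x : Fin (k + 1) → N)).card :=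
        Finset.card_biUnion_le
    _ ≤ ∑ s ∈ Sk, (F s).card := Finset.sum_le_sum fun s _ => Finset.card_image_le
    _ ≤ ∑ _s ∈ Sk, (Fintype.card N - 2 ^ k) := Finset.sum_le_sum hfib
    _ = (Fintype.card N - 2 ^ k) * Sk.card := by rw [Finset.sum_const, smul_eq_mul, mul_comm]

open scoped Classical in
/-- **There are at most `∏_{i<k} (|N| - 2^i)` doubling `k`-tuples.** [folklore] -/
theorem card_filter_doubling_le_prod (k : ℕ) :
    (Finset.univ.filter fun t : Fin k → N =>
        ∀ j : Fin k, t j ∉ closure (t '' {l : Fin k | (l : ℕ) < j})).card ≤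
      ∏ i ∈ Finset.range k, (Fintype.card N - 2 ^ i) := by
  induction k with
  | zero =>
    rw [Finset.prod_range_zero]
    calc _ ≤ (Finset.univ : Finset (Fin 0 → N)).card := Finset.card_filter_le _ _
      _ = 1 := by simp
  | succ k ih =>
    calc _ ≤ (Fintype.card N - 2 ^ k) * _ := card_filter_doubling_succ_le k
      _ ≤ (Fintype.card N - 2 ^ k) * ∏ i ∈ Finset.range k, (Fintype.card N - 2 ^ i) :=
          Nat.mul_le_mul_left _ ih
      _ = ∏ i ∈ Finset.range (k + 1), (Fintype.card N - 2 ^ i) := by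
          rw [Finset.prod_range_succ, mul_comm]

open scoped Classical in
/-- **Automorphisms inject into doubling tuples**: `σ ↦ σ ∘ g` for a generating doubling tuple
`g` (an automorphism is determined by its values on generators, and maps a doubling tuple to a
doubling tuple). [folklore] -/
theorem card_mulAut_le_card_filter_doubling {d : ℕ} {g : Fin d → N}
    (hg : ∀ j : Fin d, g j ∉ closure (g '' {l : Fin d | (l : ℕ) < j}))
    (hgen : closure (Set.range g) = ⊤) :
    Nat.card (MulAut N) ≤
      (Finset.univ.filter fun t : Fin d → N =>
        ∀ j : Fin d, t j ∉ closure (t '' {l : Fin d | (l : ℕ) < j})).card := by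
  have hgood : ∀ σ : MulAut N, ∀ j : Fin d,
      (⇑σ ∘ g) j ∉ closure ((⇑σ ∘ g) '' {l : Fin d | (l : ℕ) < j}) := by
    intro σ j hmem
    have h1 : (⇑σ ∘ g) '' {l : Fin d | (l : ℕ) < j} =
        ⇑σ.toMonoidHom '' (g '' {l : Fin d | (l : ℕ) < j}) := by
      rw [Set.image_comp]
      rfl
    rw [h1, ← MonoidHom.map_closure, mem_map_equiv] at hmem
    simp only [Function.comp_apply, MulEquiv.symm_apply_apply] at hmem
    exact hg j hmem
  let Φ : MulAut N →
      {t : Fin d → N // ∀ j : Fin d, t j ∉ closure (t '' {l : Fin d | (l : ℕ) < j})} :=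
    fun σ => ⟨⇑σ ∘ g, hgood σ⟩
  have hΦ : Function.Injective Φ := by
    intro σ τ h
    have h' : (⇑σ) ∘ g = (⇑τ) ∘ g := congrArg Subtype.val h
    apply MulEquiv.toMonoidHom_injective
    apply MonoidHom.eq_of_eqOn_dense hgen
    rintro _ ⟨j, rfl⟩
    exact congrFun h' j
  calc Nat.card (MulAut N)
      ≤ Nat.card {t : Fin d → N // ∀ j : Fin d, t j ∉ closure (t '' {l : Fin d | (l : ℕ) < j})} :=
        Nat.card_le_card_of_injective Φ hΦ
    _ = _ := by rw [Nat.card_eq_fintype_card, Fintype.card_subtype]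

end Counting

section Aut

/-- **The order of the automorphism group of a finite group**:
`|Aut N| ≤ ∏_{i < [log₂ |N|]} (|N| - 2^i)`. Choose a generating doubling tuple `g` of length `d`
(`2^d ≤ |N|`, so `d ≤ [log₂ |N|]`); automorphisms inject into doubling `d`-tuples, of which there
are at most `∏_{i<d} (|N| - 2^i)`; the remaining factors are `≥ 1`. [folklore] -/
theorem card_mulAut_le_prod (N : Type*) [Group N] [Finite N] :
    Nat.card (MulAut N) ≤
      ∏ i ∈ Finset.range (Nat.log 2 (Nat.card N)), (Nat.card N - 2 ^ i) := by
  classical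
  let _ := Fintype.ofFinite N
  obtain ⟨d, g, hg, hgen, h2d⟩ := exists_doubling_generators (N := N)
  have hn : Nat.card N ≠ 0 := Nat.card_pos.ne'
  have hd : d ≤ Nat.log 2 (Nat.card N) := Nat.le_log_of_pow_le one_lt_two h2d
  calc Nat.card (MulAut N) ≤ _ := card_mulAut_le_card_filter_doubling hg hgen
    _ ≤ ∏ i ∈ Finset.range d, (Fintype.card N - 2 ^ i) := card_filter_doubling_le_prod d
    _ = ∏ i ∈ Finset.range d, (Nat.card N - 2 ^ i) := by rw [Nat.card_eq_fintype_card]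
    _ ≤ ∏ i ∈ Finset.range (Nat.log 2 (Nat.card N)), (Nat.card N - 2 ^ i) := by
        apply Finset.prod_le_prod_of_subset_of_one_le' (Finset.range_mono hd)
        intro i hi _
        have : 2 ^ i < Nat.card N :=
          lt_of_lt_of_le (Nat.pow_lt_pow_right (by norm_num) (Finset.mem_range.mp hi))
            (Nat.pow_log_le_self 2 hn)
        omega

/-- Cruder form: `|Aut N| ≤ |N| ^ [log₂ |N|]`. [folklore] -/
theorem card_mulAut_le_pow_log (N : Type*) [Group N] [Finite N] :
    Nat.card (MulAut N) ≤ Nat.card N ^ Nat.log 2 (Nat.card N) :=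
  calc Nat.card (MulAut N) ≤ _ := card_mulAut_le_prod N
    _ ≤ ∏ _i ∈ Finset.range (Nat.log 2 (Nat.card N)), Nat.card N :=
        Finset.prod_le_prod' fun i _ => Nat.sub_le _ _
    _ = Nat.card N ^ Nat.log 2 (Nat.card N) := by simp

end Aut

end Literature.GroupTheory.PermutationGroups
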